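import Summits.CriticalPhenomena.Ising3DConformalLimit.Theorems.LeeYangGapNearCriticalLeeYangGapSmearedNonGaussianity
import Summits.CriticalPhenomena.Ising3DConformalLimit.Theorems.LeeYangGapNearCriticalLeeYangGapSmearedGaussianSide
import Summits.CriticalPhenomena.Ising3DConformalLimit.Theorems.LeeYangGapNearCriticalLeeYangGapIsothermCubeRoot

/-!
# The smeared non-Gaussianity target is exactly the non-vanishing of the critical block Binder cumulant

Assembly of `…SmearedNonGaussianity` (Binder floor frequently ⟹ target) and `…SmearedGaussianSide`
(`g_L → 0` ⟹ every smeared moment generating function `→ 1`): for the nearest-neighbour Ising model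
on `ℤ^d`, `d ≥ 3`,
`HasNonGaussianCriticalSmearing d ↔ ¬ (g_L → 0)` with `g_L = (3⟨M_L²⟩² - ⟨M_L⁴⟩)/⟨M_L²⟩²` the
critical block Binder cumulant (`0 ≤ g_L` by Lebowitz, so `¬ (g_L → 0) ↔ limsup_L g_L > 0`) — the
`U₄` criterion of Aizenman, CDM 2020, §7 (Prop. 7.1–7.2, Cor. 7.3) for the smeared field of
Aizenman–Duminil-Copin 2021, Prop. 1.4; and on `ℤ³` the survey target is crux
stmt-CriticalPhenomena-4945 verbatim up to equivalence:
`HasNonGaussianCriticalSmearing 3 ↔ NearCriticalLeeYangGap`.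
-/

noncomputable section

namespace Summit.CriticalPhenomena.Ising3DConformalLimit.LeeYangGapSmearedNonGaussianity

open MeasureTheory Filter Topology Finset
open scoped BigOperators
open Literature.Probability.LatticeModels Literature.Probability.Percolation
open Literature.Barriers.CriticalPhenomena

variable {d : ℕ}

/-- `0 ≤ 3⟨M_L²⟩² - ⟨M_L⁴⟩` in the critical plus state (`d ≥ 3`): minus a sum of Ursell functions,
each `≤ 0` by Lebowitz. [cite: Lebowitz1974, Theorem, eq. (2.5b)] -/
theorem binderNumerator_nonneg (hd : 3 ≤ d) (L : ℕ) :
    0 ≤ 3 * (plusExpect d (criticalBeta d) 0 (fun σ => (∑ x ∈ box d L, spinAt x σ) ^ 2)) ^ 2 -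
      plusExpect d (criticalBeta d) 0 (fun σ => (∑ x ∈ box d L, spinAt x σ) ^ 4) := by
  rw [three_mul_sq_sub_fourth_eq_neg_sum_ursellFour d L, neg_nonneg]
  exact Finset.sum_nonpos fun a _ => Finset.sum_nonpos fun b _ => Finset.sum_nonpos fun c _ =>
    Finset.sum_nonpos fun e _ => criticalUrsellFour_nonpos' hd a b c e

/-- **The `U₄` criterion for the smeared critical field, both directions** (`d ≥ 3`):
`HasNonGaussianCriticalSmearing d ↔ ¬ (g_L → 0)` for the critical block Binder cumulant
`g_L = (3⟨M_L²⟩² - ⟨M_L⁴⟩)/⟨M_L²⟩²`. [cite: AizenmanCDM2020, §7 Prop. 7.1–7.2 and Cor. 7.3] [cite: AizenmanDuminilCopinAnnals2021, Prop. 1.4] -/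
theorem hasNonGaussianCriticalSmearing_iff_not_tendsto_binder (hd : 3 ≤ d) :
    HasNonGaussianCriticalSmearing d ↔
      ¬ Tendsto (fun L : ℕ =>
        (3 * (plusExpect d (criticalBeta d) 0 (fun σ => (∑ x ∈ box d L, spinAt x σ) ^ 2)) ^ 2 -
            plusExpect d (criticalBeta d) 0 (fun σ => (∑ x ∈ box d L, spinAt x σ) ^ 4)) /
          (plusExpect d (criticalBeta d) 0 (fun σ => (∑ x ∈ box d L, spinAt x σ) ^ 2)) ^ 2)
        atTop (𝓝 0) := by
  refine ⟨not_tendsto_binder_of_hasNonGaussianCriticalSmearing hd, fun hnot => ?_⟩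
  set V : ℕ → ℝ := fun L => plusExpect d (criticalBeta d) 0
    (fun σ => (∑ x ∈ box d L, spinAt x σ) ^ 2) with hV
  set M4 : ℕ → ℝ := fun L => plusExpect d (criticalBeta d) 0
    (fun σ => (∑ x ∈ box d L, spinAt x σ) ^ 4) with hM4
  set g : ℕ → ℝ := fun L => (3 * V L ^ 2 - M4 L) / V L ^ 2 with hg
  change ¬ Tendsto g atTop (𝓝 0) at hnot
  have hβ := Literature.Probability.LatticeModels.criticalBeta_nonneg d
  have hVpos : ∀ L, 0 < V L := fun L => blockVariance_pos (d := d) hβ L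
  have hg0 : ∀ L, 0 ≤ g L := fun L =>
    div_nonneg (binderNumerator_nonneg hd L) (sq_nonneg _)
  obtain ⟨ε, hε, hfreq⟩ : ∃ ε : ℝ, 0 < ε ∧ ∃ᶠ L in atTop, ε ≤ g L := by
    by_contra hcon
    refine hnot (tendsto_order.2 ⟨fun a ha => Eventually.of_forall fun L => ha.trans_le (hg0 L),
      fun a ha => ?_⟩)
    by_contra hev
    exact hcon ⟨a, ha, (Filter.not_eventually.1 hev).mono fun L hL => not_lt.1 hL⟩
  refine hasNonGaussianCriticalSmearing_of_binder_frequently hd hε (hfreq.mono fun L hL => ?_)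
  exact (le_div_iff₀ (pow_pos (hVpos L) 2)).1 hL

/-- **The survey target is crux 4945**: `HasNonGaussianCriticalSmearing 3 ↔ NearCriticalLeeYangGap`
(block non-Gaussianity of critical `ℤ³` Ising in the smeared form of Aizenman–Duminil-Copin 2021,
Prop. 1.4 ⟺ a near-critical Lee–Yang zero at the fluctuation scale, route LeeYangGap).
[cite: AizenmanDuminilCopinAnnals2021, Prop. 1.4] [cite: Newman1975, Thm 3] -/
theorem hasNonGaussianCriticalSmearing_three_iff_nearCriticalLeeYangGap :
    HasNonGaussianCriticalSmearing 3 ↔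
      Summit.CriticalPhenomena.Ising3DConformalLimit.Theses.LeeYangGap.NearCriticalLeeYangGap :=
  ⟨nearCriticalLeeYangGap_of_hasNonGaussianCriticalSmearing_three,
    hasNonGaussianCriticalSmearing_three_of_nearCriticalLeeYangGap⟩

/-- **The `δ = 3` corner in smeared dress**: a mean-field critical isotherm `m(β_c(3), h) ≤ A h^{1/3}`
(small `h > 0`) already forces the survey target `HasNonGaussianCriticalSmearing 3`
(`nearCriticalLeeYangGap_of_isotherm_cuberoot`); contrapositively, on `ℤ³` at `β_c` the block law and the
isotherm amplitude cannot both be mean-field. [cite: Newman1975, Thm 3] [cite: AizenmanDuminilCopinAnnals2021, Prop. 1.4] -/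
theorem hasNonGaussianCriticalSmearing_three_of_isotherm_cuberoot
    (hI : ∃ A h₀ : ℝ, 0 < h₀ ∧ ∀ h : ℝ, 0 < h → h ≤ h₀ →
        magnetizationInField 3 (criticalBeta 3) h ≤ A * h ^ ((1:ℝ) / 3)) :
    HasNonGaussianCriticalSmearing 3 :=
  hasNonGaussianCriticalSmearing_three_of_nearCriticalLeeYangGap
    (LeeYangGapNearCriticalLeeYangGap.nearCriticalLeeYangGap_of_isotherm_cuberoot hI)

end Summit.CriticalPhenomena.Ising3DConformalLimit.LeeYangGapSmearedNonGaussianity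

end
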